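import Summits.QuantumFields.YangMills.Theorems.BalabanUVNodesN11DiagonalInductionLawsCoPH

/-!
# DAG node N11 — THEOREM 1 OF [III] ALONG THE WHOLE LARGE-FIELD DIAGONAL AT THE v1.7 `CoPH` RECORD FROM AN ABSTRACT PER-LEVEL DIAGONAL 𝐓-STEP: the induction
# `ρ_0 ↦ ρ_1 ↦ … ↦ ρ_K` along the all-large-field indices `σ_k`, its 𝐑-transfer on the live-selector line and its law package, STEP-GENERIC — whatever analytic rows the
# 𝐓-step of the day displays (dag-n11-d: `hm`∕`hC` → `hmB`∕`hCB` → `hCB` → integrability → none) enter ONLY through the one hypothesis `hstep`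

Cell `pub-ymgap`, YM-PLAN Track A (HUMAN RULING D-0062), seat `pub-ymgap-dag-n11-e` (g13; R134 fan-out row N11∕s3), route `BalabanUVNodes` rev 25 (v1.7 `CoPH` key), item K1⁷
`StabilityBAtRecordR13SepCoPH` = stmt-QuantumFields-20542 (helper lane, count-neutral).  [III] = [Balaban1988Convergent], [IV] = [Balaban1989LargeFieldI].  The step-generic form
of this seat's `…N11DiagonalInductionCoPH` (p543058) and `…N11DiagonalInductionLawsCoPH` (p549594).

WHY THIS FILE.  Theorem 1 of [III] (p. 262) along the large-field diagonal is the induction «§2 form of `ρ_k` at `σ_k` ⇒ (diagonal 𝐓-step, Theorem p. 245 at `Ω_{k+1} = ∅`)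
𝐓-image form at `σ_{k+1}` ⇒ (𝐑, p. 244 ∕ [IV]) §2 form of `ρ_{k+1}` at `σ_{k+1}`», started by def-T's `sLaw₁₃CoPH_zero` (`ρ_0` has no terms).  This seat's accepted inductions
(p543058 ∕ p549594, engine p536887) hard-wire dag-n11-d's diagonal 𝐓-step of the v1.6∕v1.7 editions together with ITS displayed analytic rows (measurability `hmB` and a uniform
bound `hCB` of the old branch per level).  Those rows are being retired by dag-n11-d one by one (`hmB` a theorem along the diagonal: `…N11DiagonalOldBranchMeasurable`; `hCB`
re-typed to integrability: `…N11NoExpansionGeneralStepIntegrable`; announced: the diagonal step with NO analytic binder).  The induction, the 𝐑-transfer and the law package do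
not read those rows.  So this file states them ONCE against an ABSTRACT clause-keyed per-level step `hstep` — «for `k < K` and every witness `(t₀, E₀)` carrying the post-𝐑
clause of `ρ_k` at `σ_k` (history-indexed residual `θ.rzAt p σ_k`, weights `WtOfRecord₁₃H θ p σ_k`), the 𝐓-image clause at `σ_{k+1}` holds for EVERY `t′` with the same
constant» (the shape of every dag-n11-d diagonal step: the diagonal is term-free) — and every present or future diagonal 𝐓-step instantiates it in one line.  HENCE:
§1 (generic `θ : Stage13HParams`, core provisos — rows `rstep` for the 𝐑-side —, node00-def-T's live-selector clause) ★★★ `diag_slotClause_all_CoPH_of_step_of_liveSel`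
   (∀ `k ≤ K`, ∃ `(t, E)`, the post-𝐑 §2 dichotomy of `ρ_k`'s slot at `σ_k`) · `diag_slotClause_succ_forall_terms_CoPH_of_step_of_liveSel` (above level 0 for EVERY witness) ·
   ★★★ `diag_lawsRT_slotClause_all_CoPH_of_step_of_liveSel` (with the law package `LawsRT … k` — zero witness, `lawsRT_sect2TowerOfRecord_zero`; + `0 ≤ g₀, E₀, B₀`).
§2 (door of node00-def-K0a's cured family, `θ₀.Provisos₁₃Core`) `diag_lawsRT_slotClause_all_doorCured_of_step_of_liveSel` · ★★★
   `diag_lawsRT_slotClause_all_doorCured_theta13LiveOfRecord_of_step` (at the witness of record: selector clause K0a's `liveRepin₁₃_liveSel`, `M = 1`, `E₀ = B₀ = 1`).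
Instances: with dag-n11-d's `clause_succ_CoPH_of_provisos_of_clause` (+ pins, `hmB`, `hCB`) `hstep` is p543058's step; with `…DiagonalOldBranchMeasurable` §4 the `hmB` row
drops (this seat's `…N11DiagonalInductionHCBCoPH`); with the announced binder-free step, Theorem 1 along the whole diagonal at the door follows from `Provisos₁₃Core` + the selector
clause ALONE — each a one-line application of this file.

HONEST FRAMING.  Count-neutral kernel bookkeeping (an induction on `k` over two tree theorems: def-T's `sLaw₁₃CoPH_zero`, this seat's `slotClauseΦ_succ_of_slotTClauseΦ_of_liveSel_of_rstep`);
the 𝐓-step is a HYPOTHESIS here (displayed `hstep`), not asserted; the zero branch of the dichotomy is not excluded; off the diagonal nothing is said (`Ω_{k+1} ≠ ∅` = [III]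
Sect. 1 ∕ §3 ∕ Thm 2 proper); nothing of Bałaban asserted; N11 NOT discharged; K1⁷ NOT closed; counts unmoved (typed 28∕28 · discharged 5∕27).  One finite `𝕋⁴_{L^K}` programme
at fixed `ε = L^{−K}`; NOT ℝ⁴, NOT OS, NOT a mass gap, NOT Clay.
Sources: [III] Thm 1 p.262, §2 p.262, Theorem p.245, (2.17)–(2.18) p.257, (2.27)–(2.31) pp.259–260, (3.24)–(3.25) p.270, (1.11) p.248, (3.16)–(3.22) pp.268–269;
[IV] (0.3)–(0.4) p.176, p.177 (i)–(ii); [Balaban1987RG1] (0.20) p.256.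
-/

noncomputable section

open MeasureTheory
open scoped BigOperators Matrix.Norms.L2Operator

namespace Summit.QuantumFields.YangMills.Theorems.BalabanUVNodesN11DiagonalInductionStepCoPH

open Literature.MathematicalPhysics.QuantumFieldTheory.Balaban1983to89 T4Continuum Node00 Node00.Tk DagBinding
open Literature.MathematicalPhysics.QuantumFieldTheory.Balaban1983to89.B16RLeafRecord13LiveGenericZS
open Literature.MathematicalPhysics.QuantumFieldTheory.Balaban1983to89.B16RLeafRecord13AtLive (liveRepin₁₃_liveSel)
open BalabanUVNodesN11DiagonalInductionLawsCoPH (lawsRT_sect2TowerOfRecord_zero)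

variable {F : T4Family} {N : ℕ} [NeZero N]

/-! ## §1. Generic `θ : Stage13HParams` — the induction, its 𝐑-transfer and its law package from an abstract per-level diagonal 𝐓-step -/

section Generic

variable (θ : Stage13HParams F N) (p : B12.RunParams)

/-- **★★★ THEOREM 1 ALONG THE LARGE-FIELD DIAGONAL FROM AN ABSTRACT PER-LEVEL 𝐓-STEP** — for every `k ≤ K` THERE ARE term values and a constant with the post-𝐑 §2 dichotomy of
`ρ_k`'s slot at the all-large-field index `σ_k` (history-indexed residual `θ.rzAt p σ_k`, weights `WtOfRecord₁₃H θ p σ_k`, def-R's background).  Hypotheses: node00-def-T's v1.7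
core provisos (row `rstep`: the 𝐑-side), the live-selector clause, and the displayed clause-keyed diagonal 𝐓-step `hstep` («the post-𝐑 clause of `ρ_k` at `σ_k` for `(t₀, E₀)` ⇒
the 𝐓-image clause at `σ_{k+1}` for EVERY `t′`, same constant», `k < K`).  Induction on `k`: start def-T's `sLaw₁₃CoPH_zero` read at `σ_0`; step `hstep` then this seat's
`slotClauseΦ_succ_of_slotTClauseΦ_of_liveSel_of_rstep` (𝐑 of record moves only dead sequences). [cite: Balaban1988Convergent, Thm 1 p.262, Theorem p.245, (3.24)–(3.25) p.270, (2.17)–(2.18) p.257; Balaban1989LargeFieldI, (0.3)–(0.4) p.176, p.177 (i)–(ii)] -/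
theorem diag_slotClause_all_CoPH_of_step_of_liveSel (h : θ.Provisos₁₃CoPH F N)
    (hsel : θ.ppSel = ppSelLiveOfRecord F N θ.ν θ.τ9 (EOfRecord₁₃ F N θ.toStage13Params) (wOfRecord₉ F N θ.toStage9Params))
    (hstep : ∀ k, k < p.K → ∀ (t₀ : Sect2.TermValues (F.P p.K) (MatA N) (FluctV N) θ.τ9.M) (E₀ : ℝ),
      (slotsOfRecord F N θ.ν θ.τ9 (EOfRecord₁₃ F N θ.toStage13Params) (wOfRecord₉ F N θ.toStage9Params) θ.ppSel p (gOfRecord₁₃ F N θ.toStage13Params p) k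
            (seqAllLargeOfRecord F θ.ν θ.τ9.M (gOfRecord₁₃ F N θ.toStage13Params p) p.K k) = 0 ∨
          ∀ᵐ U ∂fieldMeasure (F.P p.K) k (SU N),
            chiSeqOfRecord F N θ.ν θ.τ9.M (gOfRecord₁₃ F N θ.toStage13Params p) p.K k (seqAllLargeOfRecord F θ.ν θ.τ9.M (gOfRecord₁₃ F N θ.toStage13Params p) p.K k) U ≠ 0 →
              slotsOfRecord F N θ.ν θ.τ9 (EOfRecord₁₃ F N θ.toStage13Params) (wOfRecord₉ F N θ.toStage9Params) θ.ppSel p (gOfRecord₁₃ F N θ.toStage13Params p) k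
                  (seqAllLargeOfRecord F θ.ν θ.τ9.M (gOfRecord₁₃ F N θ.toStage13Params p) p.K k) U =
                sect2Slot F N (FluctV N) p.K (settingOfRecord₁₃ F N θ.toStage13Params p)
                  (θ.rzAt p (seqAllLargeOfRecord F θ.ν θ.τ9.M (gOfRecord₁₃ F N θ.toStage13Params p) p.K k))
                  (WtOfRecord₁₃H F N θ p (seqAllLargeOfRecord F θ.ν θ.τ9.M (gOfRecord₁₃ F N θ.toStage13Params p) p.K k))
                  (seqAllLargeOfRecord F θ.ν θ.τ9.M (gOfRecord₁₃ F N θ.toStage13Params p) p.K k) t₀ E₀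
                  (UbgOfRecord₁₃CoP F N θ.toStage13Params p k (seqAllLargeOfRecord F θ.ν θ.τ9.M (gOfRecord₁₃ F N θ.toStage13Params p) p.K k)) U) →
      ∀ t' : Sect2.TermValues (F.P p.K) (MatA N) (FluctV N) θ.τ9.M,
        slotsTOfRecord F N θ.ν θ.τ9 (EOfRecord₁₃ F N θ.toStage13Params) (wOfRecord₉ F N θ.toStage9Params) θ.ppSel p (gOfRecord₁₃ F N θ.toStage13Params p) (k + 1)
            (seqAllLargeOfRecord F θ.ν θ.τ9.M (gOfRecord₁₃ F N θ.toStage13Params p) p.K (k + 1)) = 0 ∨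
          ∀ᵐ V ∂fieldMeasure (F.P p.K) (k + 1) (SU N),
            chiSeqOfRecord F N θ.ν θ.τ9.M (gOfRecord₁₃ F N θ.toStage13Params p) p.K (k + 1)
                (seqAllLargeOfRecord F θ.ν θ.τ9.M (gOfRecord₁₃ F N θ.toStage13Params p) p.K (k + 1)) V ≠ 0 →
              slotsTOfRecord F N θ.ν θ.τ9 (EOfRecord₁₃ F N θ.toStage13Params) (wOfRecord₉ F N θ.toStage9Params) θ.ppSel p (gOfRecord₁₃ F N θ.toStage13Params p) (k + 1)
                  (seqAllLargeOfRecord F θ.ν θ.τ9.M (gOfRecord₁₃ F N θ.toStage13Params p) p.K (k + 1)) V =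
                sect2Slot F N (FluctV N) p.K (settingOfRecord₁₃ F N θ.toStage13Params p)
                  (θ.rzAt p (seqAllLargeOfRecord F θ.ν θ.τ9.M (gOfRecord₁₃ F N θ.toStage13Params p) p.K (k + 1)))
                  (WtOfRecord₁₃H F N θ p (seqAllLargeOfRecord F θ.ν θ.τ9.M (gOfRecord₁₃ F N θ.toStage13Params p) p.K (k + 1)))
                  (seqAllLargeOfRecord F θ.ν θ.τ9.M (gOfRecord₁₃ F N θ.toStage13Params p) p.K (k + 1)) t' E₀
                  (UbgOfRecord₁₃CoP F N θ.toStage13Params p (k + 1) (seqAllLargeOfRecord F θ.ν θ.τ9.M (gOfRecord₁₃ F N θ.toStage13Params p) p.K (k + 1))) V) :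
    ∀ k, k ≤ p.K → ∃ (t : Sect2.TermValues (F.P p.K) (MatA N) (FluctV N) θ.τ9.M) (E : ℝ),
      slotsOfRecord F N θ.ν θ.τ9 (EOfRecord₁₃ F N θ.toStage13Params) (wOfRecord₉ F N θ.toStage9Params) θ.ppSel p (gOfRecord₁₃ F N θ.toStage13Params p) k
          (seqAllLargeOfRecord F θ.ν θ.τ9.M (gOfRecord₁₃ F N θ.toStage13Params p) p.K k) = 0 ∨
        ∀ᵐ U ∂fieldMeasure (F.P p.K) k (SU N),
          chiSeqOfRecord F N θ.ν θ.τ9.M (gOfRecord₁₃ F N θ.toStage13Params p) p.K k (seqAllLargeOfRecord F θ.ν θ.τ9.M (gOfRecord₁₃ F N θ.toStage13Params p) p.K k) U ≠ 0 →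
            slotsOfRecord F N θ.ν θ.τ9 (EOfRecord₁₃ F N θ.toStage13Params) (wOfRecord₉ F N θ.toStage9Params) θ.ppSel p (gOfRecord₁₃ F N θ.toStage13Params p) k
                (seqAllLargeOfRecord F θ.ν θ.τ9.M (gOfRecord₁₃ F N θ.toStage13Params p) p.K k) U =
              sect2Slot F N (FluctV N) p.K (settingOfRecord₁₃ F N θ.toStage13Params p)
                (θ.rzAt p (seqAllLargeOfRecord F θ.ν θ.τ9.M (gOfRecord₁₃ F N θ.toStage13Params p) p.K k))
                (WtOfRecord₁₃H F N θ p (seqAllLargeOfRecord F θ.ν θ.τ9.M (gOfRecord₁₃ F N θ.toStage13Params p) p.K k))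
                (seqAllLargeOfRecord F θ.ν θ.τ9.M (gOfRecord₁₃ F N θ.toStage13Params p) p.K k) t E
                (UbgOfRecord₁₃CoP F N θ.toStage13Params p k (seqAllLargeOfRecord F θ.ν θ.τ9.M (gOfRecord₁₃ F N θ.toStage13Params p) p.K k)) U := by
  intro k
  induction k with
  | zero =>
    intro _
    -- the start: `ρ₀` has the §2 form (def-T's `sLaw₁₃CoPH_zero`), read at the all-large index of length `0`
    obtain ⟨t, Ek, -, hs⟩ := (sLaw₁₃CoPH_iff F N θ p 0).mp (sLaw₁₃CoPH_zero F N θ p)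
    exact ⟨t _, Ek _, (hs (seqAllLargeOfRecord F θ.ν θ.τ9.M (gOfRecord₁₃ F N θ.toStage13Params p) p.K 0)).2⟩
  | succ k ih =>
    intro hk1
    have hk : k < p.K := Nat.lt_of_succ_le hk1
    obtain ⟨t₀, E₀, hid⟩ := ih hk.le
    -- 𝐓-side: the displayed step, same witness and constant; 𝐑-side: this seat's Φ-generic transfer at one sequence on the live-selector line
    exact ⟨t₀, E₀, slotClauseΦ_succ_of_slotTClauseΦ_of_liveSel_of_rstep F N θ.toStage13Params p (fun p k _ hk => h.rstep p k hk) hsel k hk _ _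
      fun _ => hstep k hk t₀ E₀ hid t₀⟩

/-- **… AND ABOVE LEVEL 0 FOR EVERY TERM-VALUE WITNESS**: from the level-`k` witness of the induction and the step (whose conclusion serves EVERY `t′` — the diagonal is
term-free) the post-𝐑 clause at `σ_{k+1}` holds for every `t′`, with the carried constant. [cite: Balaban1988Convergent, Thm 1 p.262, (2.20)–(2.23) p.258, (3.24)–(3.25) p.270; Balaban1989LargeFieldI, (0.3) p.176, p.177 (i)–(ii)] -/
theorem diag_slotClause_succ_forall_terms_CoPH_of_step_of_liveSel (h : θ.Provisos₁₃CoPH F N)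
    (hsel : θ.ppSel = ppSelLiveOfRecord F N θ.ν θ.τ9 (EOfRecord₁₃ F N θ.toStage13Params) (wOfRecord₉ F N θ.toStage9Params))
    (hstep : ∀ k, k < p.K → ∀ (t₀ : Sect2.TermValues (F.P p.K) (MatA N) (FluctV N) θ.τ9.M) (E₀ : ℝ),
      (slotsOfRecord F N θ.ν θ.τ9 (EOfRecord₁₃ F N θ.toStage13Params) (wOfRecord₉ F N θ.toStage9Params) θ.ppSel p (gOfRecord₁₃ F N θ.toStage13Params p) k
            (seqAllLargeOfRecord F θ.ν θ.τ9.M (gOfRecord₁₃ F N θ.toStage13Params p) p.K k) = 0 ∨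
          ∀ᵐ U ∂fieldMeasure (F.P p.K) k (SU N),
            chiSeqOfRecord F N θ.ν θ.τ9.M (gOfRecord₁₃ F N θ.toStage13Params p) p.K k (seqAllLargeOfRecord F θ.ν θ.τ9.M (gOfRecord₁₃ F N θ.toStage13Params p) p.K k) U ≠ 0 →
              slotsOfRecord F N θ.ν θ.τ9 (EOfRecord₁₃ F N θ.toStage13Params) (wOfRecord₉ F N θ.toStage9Params) θ.ppSel p (gOfRecord₁₃ F N θ.toStage13Params p) k
                  (seqAllLargeOfRecord F θ.ν θ.τ9.M (gOfRecord₁₃ F N θ.toStage13Params p) p.K k) U =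
                sect2Slot F N (FluctV N) p.K (settingOfRecord₁₃ F N θ.toStage13Params p)
                  (θ.rzAt p (seqAllLargeOfRecord F θ.ν θ.τ9.M (gOfRecord₁₃ F N θ.toStage13Params p) p.K k))
                  (WtOfRecord₁₃H F N θ p (seqAllLargeOfRecord F θ.ν θ.τ9.M (gOfRecord₁₃ F N θ.toStage13Params p) p.K k))
                  (seqAllLargeOfRecord F θ.ν θ.τ9.M (gOfRecord₁₃ F N θ.toStage13Params p) p.K k) t₀ E₀
                  (UbgOfRecord₁₃CoP F N θ.toStage13Params p k (seqAllLargeOfRecord F θ.ν θ.τ9.M (gOfRecord₁₃ F N θ.toStage13Params p) p.K k)) U) →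
      ∀ t' : Sect2.TermValues (F.P p.K) (MatA N) (FluctV N) θ.τ9.M,
        slotsTOfRecord F N θ.ν θ.τ9 (EOfRecord₁₃ F N θ.toStage13Params) (wOfRecord₉ F N θ.toStage9Params) θ.ppSel p (gOfRecord₁₃ F N θ.toStage13Params p) (k + 1)
            (seqAllLargeOfRecord F θ.ν θ.τ9.M (gOfRecord₁₃ F N θ.toStage13Params p) p.K (k + 1)) = 0 ∨
          ∀ᵐ V ∂fieldMeasure (F.P p.K) (k + 1) (SU N),
            chiSeqOfRecord F N θ.ν θ.τ9.M (gOfRecord₁₃ F N θ.toStage13Params p) p.K (k + 1)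
                (seqAllLargeOfRecord F θ.ν θ.τ9.M (gOfRecord₁₃ F N θ.toStage13Params p) p.K (k + 1)) V ≠ 0 →
              slotsTOfRecord F N θ.ν θ.τ9 (EOfRecord₁₃ F N θ.toStage13Params) (wOfRecord₉ F N θ.toStage9Params) θ.ppSel p (gOfRecord₁₃ F N θ.toStage13Params p) (k + 1)
                  (seqAllLargeOfRecord F θ.ν θ.τ9.M (gOfRecord₁₃ F N θ.toStage13Params p) p.K (k + 1)) V =
                sect2Slot F N (FluctV N) p.K (settingOfRecord₁₃ F N θ.toStage13Params p)
                  (θ.rzAt p (seqAllLargeOfRecord F θ.ν θ.τ9.M (gOfRecord₁₃ F N θ.toStage13Params p) p.K (k + 1)))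
                  (WtOfRecord₁₃H F N θ p (seqAllLargeOfRecord F θ.ν θ.τ9.M (gOfRecord₁₃ F N θ.toStage13Params p) p.K (k + 1)))
                  (seqAllLargeOfRecord F θ.ν θ.τ9.M (gOfRecord₁₃ F N θ.toStage13Params p) p.K (k + 1)) t' E₀
                  (UbgOfRecord₁₃CoP F N θ.toStage13Params p (k + 1) (seqAllLargeOfRecord F θ.ν θ.τ9.M (gOfRecord₁₃ F N θ.toStage13Params p) p.K (k + 1))) V)
    (k : ℕ) (hk : k < p.K) (t' : Sect2.TermValues (F.P p.K) (MatA N) (FluctV N) θ.τ9.M) :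
    ∃ E : ℝ,
      slotsOfRecord F N θ.ν θ.τ9 (EOfRecord₁₃ F N θ.toStage13Params) (wOfRecord₉ F N θ.toStage9Params) θ.ppSel p (gOfRecord₁₃ F N θ.toStage13Params p) (k + 1)
          (seqAllLargeOfRecord F θ.ν θ.τ9.M (gOfRecord₁₃ F N θ.toStage13Params p) p.K (k + 1)) = 0 ∨
        ∀ᵐ U ∂fieldMeasure (F.P p.K) (k + 1) (SU N),
          chiSeqOfRecord F N θ.ν θ.τ9.M (gOfRecord₁₃ F N θ.toStage13Params p) p.K (k + 1)
              (seqAllLargeOfRecord F θ.ν θ.τ9.M (gOfRecord₁₃ F N θ.toStage13Params p) p.K (k + 1)) U ≠ 0 →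
            slotsOfRecord F N θ.ν θ.τ9 (EOfRecord₁₃ F N θ.toStage13Params) (wOfRecord₉ F N θ.toStage9Params) θ.ppSel p (gOfRecord₁₃ F N θ.toStage13Params p) (k + 1)
                (seqAllLargeOfRecord F θ.ν θ.τ9.M (gOfRecord₁₃ F N θ.toStage13Params p) p.K (k + 1)) U =
              sect2Slot F N (FluctV N) p.K (settingOfRecord₁₃ F N θ.toStage13Params p)
                (θ.rzAt p (seqAllLargeOfRecord F θ.ν θ.τ9.M (gOfRecord₁₃ F N θ.toStage13Params p) p.K (k + 1)))
                (WtOfRecord₁₃H F N θ p (seqAllLargeOfRecord F θ.ν θ.τ9.M (gOfRecord₁₃ F N θ.toStage13Params p) p.K (k + 1)))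
                (seqAllLargeOfRecord F θ.ν θ.τ9.M (gOfRecord₁₃ F N θ.toStage13Params p) p.K (k + 1)) t' E
                (UbgOfRecord₁₃CoP F N θ.toStage13Params p (k + 1) (seqAllLargeOfRecord F θ.ν θ.τ9.M (gOfRecord₁₃ F N θ.toStage13Params p) p.K (k + 1))) U := by
  obtain ⟨t₀, E₀, hid⟩ := diag_slotClause_all_CoPH_of_step_of_liveSel θ p h hsel hstep k hk.le
  exact ⟨E₀, slotClauseΦ_succ_of_slotTClauseΦ_of_liveSel_of_rstep F N θ.toStage13Params p (fun p k _ hk => h.rstep p k hk) hsel k hk _ _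
    fun _ => hstep k hk t₀ E₀ hid t'⟩

/-- **★★★ THEOREM 1 ALONG THE LARGE-FIELD DIAGONAL WITH ITS LAW PACKAGE, FROM AN ABSTRACT PER-LEVEL 𝐓-STEP** — for every `k ≤ K` THERE ARE term values and a constant carrying
BOTH conjuncts of `SLaw₁₃CoPH θ p k`'s predicate at `σ_k`: the inductive assumptions `Sect2.LawsRT (sect2TowerOfRecord … (θ.rzAt p σ_k) σ_k t) lf k` AND the post-𝐑 §2 dichotomy
of `ρ_k`'s slot.  Extra hypotheses: the run's `0 ≤ g₀` and the signs `0 ≤ E₀, B₀`.  Level 0: the clause-level theorem + `LawsRT.zero`; level `k+1`: the step serves EVERY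
witness, so take the ZERO witness, whose inductive assumptions hold at every index (this seat's `lawsRT_sect2TowerOfRecord_zero`). [cite: Balaban1988Convergent, Thm 1 p.262, §2 p.262, Theorem p.245, (3.24)–(3.25) p.270, (2.27)–(2.31) pp.259–260; Balaban1989LargeFieldI, (0.3) p.176, p.177 (i)–(ii); Balaban1987RG1, (0.20) p.256] -/
theorem diag_lawsRT_slotClause_all_CoPH_of_step_of_liveSel (h : θ.Provisos₁₃CoPH F N)
    (hg0 : 0 ≤ p.g0) (hE₀ : 0 ≤ θ.s2.lf.E₀) (hB₀ : 0 ≤ θ.s2.lf.B₀)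
    (hsel : θ.ppSel = ppSelLiveOfRecord F N θ.ν θ.τ9 (EOfRecord₁₃ F N θ.toStage13Params) (wOfRecord₉ F N θ.toStage9Params))
    (hstep : ∀ k, k < p.K → ∀ (t₀ : Sect2.TermValues (F.P p.K) (MatA N) (FluctV N) θ.τ9.M) (E₀ : ℝ),
      (slotsOfRecord F N θ.ν θ.τ9 (EOfRecord₁₃ F N θ.toStage13Params) (wOfRecord₉ F N θ.toStage9Params) θ.ppSel p (gOfRecord₁₃ F N θ.toStage13Params p) k
            (seqAllLargeOfRecord F θ.ν θ.τ9.M (gOfRecord₁₃ F N θ.toStage13Params p) p.K k) = 0 ∨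
          ∀ᵐ U ∂fieldMeasure (F.P p.K) k (SU N),
            chiSeqOfRecord F N θ.ν θ.τ9.M (gOfRecord₁₃ F N θ.toStage13Params p) p.K k (seqAllLargeOfRecord F θ.ν θ.τ9.M (gOfRecord₁₃ F N θ.toStage13Params p) p.K k) U ≠ 0 →
              slotsOfRecord F N θ.ν θ.τ9 (EOfRecord₁₃ F N θ.toStage13Params) (wOfRecord₉ F N θ.toStage9Params) θ.ppSel p (gOfRecord₁₃ F N θ.toStage13Params p) k
                  (seqAllLargeOfRecord F θ.ν θ.τ9.M (gOfRecord₁₃ F N θ.toStage13Params p) p.K k) U =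
                sect2Slot F N (FluctV N) p.K (settingOfRecord₁₃ F N θ.toStage13Params p)
                  (θ.rzAt p (seqAllLargeOfRecord F θ.ν θ.τ9.M (gOfRecord₁₃ F N θ.toStage13Params p) p.K k))
                  (WtOfRecord₁₃H F N θ p (seqAllLargeOfRecord F θ.ν θ.τ9.M (gOfRecord₁₃ F N θ.toStage13Params p) p.K k))
                  (seqAllLargeOfRecord F θ.ν θ.τ9.M (gOfRecord₁₃ F N θ.toStage13Params p) p.K k) t₀ E₀
                  (UbgOfRecord₁₃CoP F N θ.toStage13Params p k (seqAllLargeOfRecord F θ.ν θ.τ9.M (gOfRecord₁₃ F N θ.toStage13Params p) p.K k)) U) →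
      ∀ t' : Sect2.TermValues (F.P p.K) (MatA N) (FluctV N) θ.τ9.M,
        slotsTOfRecord F N θ.ν θ.τ9 (EOfRecord₁₃ F N θ.toStage13Params) (wOfRecord₉ F N θ.toStage9Params) θ.ppSel p (gOfRecord₁₃ F N θ.toStage13Params p) (k + 1)
            (seqAllLargeOfRecord F θ.ν θ.τ9.M (gOfRecord₁₃ F N θ.toStage13Params p) p.K (k + 1)) = 0 ∨
          ∀ᵐ V ∂fieldMeasure (F.P p.K) (k + 1) (SU N),
            chiSeqOfRecord F N θ.ν θ.τ9.M (gOfRecord₁₃ F N θ.toStage13Params p) p.K (k + 1)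
                (seqAllLargeOfRecord F θ.ν θ.τ9.M (gOfRecord₁₃ F N θ.toStage13Params p) p.K (k + 1)) V ≠ 0 →
              slotsTOfRecord F N θ.ν θ.τ9 (EOfRecord₁₃ F N θ.toStage13Params) (wOfRecord₉ F N θ.toStage9Params) θ.ppSel p (gOfRecord₁₃ F N θ.toStage13Params p) (k + 1)
                  (seqAllLargeOfRecord F θ.ν θ.τ9.M (gOfRecord₁₃ F N θ.toStage13Params p) p.K (k + 1)) V =
                sect2Slot F N (FluctV N) p.K (settingOfRecord₁₃ F N θ.toStage13Params p)
                  (θ.rzAt p (seqAllLargeOfRecord F θ.ν θ.τ9.M (gOfRecord₁₃ F N θ.toStage13Params p) p.K (k + 1)))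
                  (WtOfRecord₁₃H F N θ p (seqAllLargeOfRecord F θ.ν θ.τ9.M (gOfRecord₁₃ F N θ.toStage13Params p) p.K (k + 1)))
                  (seqAllLargeOfRecord F θ.ν θ.τ9.M (gOfRecord₁₃ F N θ.toStage13Params p) p.K (k + 1)) t' E₀
                  (UbgOfRecord₁₃CoP F N θ.toStage13Params p (k + 1) (seqAllLargeOfRecord F θ.ν θ.τ9.M (gOfRecord₁₃ F N θ.toStage13Params p) p.K (k + 1))) V) :
    ∀ k, k ≤ p.K → ∃ (t : Sect2.TermValues (F.P p.K) (MatA N) (FluctV N) θ.τ9.M) (E : ℝ),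
      Sect2.LawsRT (sect2TowerOfRecord F N (FluctV N) p.K (settingOfRecord₁₃ F N θ.toStage13Params p)
        (θ.rzAt p (seqAllLargeOfRecord F θ.ν θ.τ9.M (gOfRecord₁₃ F N θ.toStage13Params p) p.K k))
        (seqAllLargeOfRecord F θ.ν θ.τ9.M (gOfRecord₁₃ F N θ.toStage13Params p) p.K k) t) (settingOfRecord₁₃ F N θ.toStage13Params p).lf k ∧
     (slotsOfRecord F N θ.ν θ.τ9 (EOfRecord₁₃ F N θ.toStage13Params) (wOfRecord₉ F N θ.toStage9Params) θ.ppSel p (gOfRecord₁₃ F N θ.toStage13Params p) k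
          (seqAllLargeOfRecord F θ.ν θ.τ9.M (gOfRecord₁₃ F N θ.toStage13Params p) p.K k) = 0 ∨
        ∀ᵐ U ∂fieldMeasure (F.P p.K) k (SU N),
          chiSeqOfRecord F N θ.ν θ.τ9.M (gOfRecord₁₃ F N θ.toStage13Params p) p.K k (seqAllLargeOfRecord F θ.ν θ.τ9.M (gOfRecord₁₃ F N θ.toStage13Params p) p.K k) U ≠ 0 →
            slotsOfRecord F N θ.ν θ.τ9 (EOfRecord₁₃ F N θ.toStage13Params) (wOfRecord₉ F N θ.toStage9Params) θ.ppSel p (gOfRecord₁₃ F N θ.toStage13Params p) k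
                (seqAllLargeOfRecord F θ.ν θ.τ9.M (gOfRecord₁₃ F N θ.toStage13Params p) p.K k) U =
              sect2Slot F N (FluctV N) p.K (settingOfRecord₁₃ F N θ.toStage13Params p)
                (θ.rzAt p (seqAllLargeOfRecord F θ.ν θ.τ9.M (gOfRecord₁₃ F N θ.toStage13Params p) p.K k))
                (WtOfRecord₁₃H F N θ p (seqAllLargeOfRecord F θ.ν θ.τ9.M (gOfRecord₁₃ F N θ.toStage13Params p) p.K k))
                (seqAllLargeOfRecord F θ.ν θ.τ9.M (gOfRecord₁₃ F N θ.toStage13Params p) p.K k) t E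
                (UbgOfRecord₁₃CoP F N θ.toStage13Params p k (seqAllLargeOfRecord F θ.ν θ.τ9.M (gOfRecord₁₃ F N θ.toStage13Params p) p.K k)) U) := by
  intro k hk
  rcases k with _ | k
  · obtain ⟨t, E, hcl⟩ := diag_slotClause_all_CoPH_of_step_of_liveSel θ p h hsel hstep 0 hk
    exact ⟨t, E, Sect2.LawsRT.zero _ _, hcl⟩
  · -- above level 0 the step serves EVERY witness: take the ZERO witness, whose inductive assumptions hold at every index
    obtain ⟨E, hcl⟩ := diag_slotClause_succ_forall_terms_CoPH_of_step_of_liveSel θ p h hsel hstep k (Nat.lt_of_succ_le hk) Sect2.TermValues.zero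
    exact ⟨Sect2.TermValues.zero, E, lawsRT_sect2TowerOfRecord_zero F N θ.toStage13Params p hg0 hE₀ hB₀ _ _ (k + 1), hcl⟩

end Generic

/-! ## §2. At the history-blind door of node00-def-K0a's cured family and at the door of the cured witness of record -/

section DoorCured

variable (θ₀ : Stage13Params F N) (p : B12.RunParams)

/-- **★★★ … AT THE DOOR `Stage13HParams.ofHistoryBlind (Stage13RParams.ofCured θ₀)` OF K0a's CURED FAMILY**, laws included: from `θ₀.Provisos₁₃Core` (K0a's `Provisos₁₃Core.ofCured`,
def-T's `Provisos₁₃CoPR.ofHistoryBlind`), node00-def-T's selector clause of `θ₀`, `0 ≤ g₀`, `0 ≤ E₀, B₀`, and the displayed per-level diagonal 𝐓-step AT THE DOOR.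
[cite: Balaban1988Convergent, Thm 1 p.262, §2 p.262, Theorem p.245, (3.24)–(3.25) p.270, (1.11) p.248, (3.16)–(3.20) pp.268–269; Balaban1989LargeFieldI, (0.3) p.176, p.177 (i)–(ii); Balaban1987RG1, (0.20) p.256] -/
theorem diag_lawsRT_slotClause_all_doorCured_of_step_of_liveSel (h : θ₀.Provisos₁₃Core F N)
    (hg0 : 0 ≤ p.g0) (hE₀ : 0 ≤ θ₀.s2.lf.E₀) (hB₀ : 0 ≤ θ₀.s2.lf.B₀)
    (hsel : θ₀.ppSel = ppSelLiveOfRecord F N θ₀.ν θ₀.τ9 (EOfRecord₁₃ F N θ₀) (wOfRecord₉ F N θ₀.toStage9Params))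
    (hstep : ∀ k, k < p.K → ∀ (t₀ : Sect2.TermValues (F.P p.K) (MatA N) (FluctV N) θ₀.τ9.M) (E₀ : ℝ),
      (slotsOfRecord F N θ₀.ν θ₀.τ9 (EOfRecord₁₃ F N θ₀) (wOfRecord₉ F N θ₀.toStage9Params) θ₀.ppSel p (gOfRecord₁₃ F N θ₀ p) k
            (seqAllLargeOfRecord F θ₀.ν θ₀.τ9.M (gOfRecord₁₃ F N θ₀ p) p.K k) = 0 ∨
          ∀ᵐ U ∂fieldMeasure (F.P p.K) k (SU N),
            chiSeqOfRecord F N θ₀.ν θ₀.τ9.M (gOfRecord₁₃ F N θ₀ p) p.K k (seqAllLargeOfRecord F θ₀.ν θ₀.τ9.M (gOfRecord₁₃ F N θ₀ p) p.K k) U ≠ 0 →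
              slotsOfRecord F N θ₀.ν θ₀.τ9 (EOfRecord₁₃ F N θ₀) (wOfRecord₉ F N θ₀.toStage9Params) θ₀.ppSel p (gOfRecord₁₃ F N θ₀ p) k
                  (seqAllLargeOfRecord F θ₀.ν θ₀.τ9.M (gOfRecord₁₃ F N θ₀ p) p.K k) U =
                sect2Slot F N (FluctV N) p.K (settingOfRecord₁₃ F N θ₀ p)
                  ((Stage13HParams.ofHistoryBlind F N (Stage13RParams.ofCured F N θ₀)).rzAt p (seqAllLargeOfRecord F θ₀.ν θ₀.τ9.M (gOfRecord₁₃ F N θ₀ p) p.K k))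
                  (WtOfRecord₁₃H F N (Stage13HParams.ofHistoryBlind F N (Stage13RParams.ofCured F N θ₀)) p
                    (seqAllLargeOfRecord F θ₀.ν θ₀.τ9.M (gOfRecord₁₃ F N θ₀ p) p.K k))
                  (seqAllLargeOfRecord F θ₀.ν θ₀.τ9.M (gOfRecord₁₃ F N θ₀ p) p.K k) t₀ E₀
                  (UbgOfRecord₁₃CoP F N θ₀ p k (seqAllLargeOfRecord F θ₀.ν θ₀.τ9.M (gOfRecord₁₃ F N θ₀ p) p.K k)) U) →
      ∀ t' : Sect2.TermValues (F.P p.K) (MatA N) (FluctV N) θ₀.τ9.M,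
        slotsTOfRecord F N θ₀.ν θ₀.τ9 (EOfRecord₁₃ F N θ₀) (wOfRecord₉ F N θ₀.toStage9Params) θ₀.ppSel p (gOfRecord₁₃ F N θ₀ p) (k + 1)
            (seqAllLargeOfRecord F θ₀.ν θ₀.τ9.M (gOfRecord₁₃ F N θ₀ p) p.K (k + 1)) = 0 ∨
          ∀ᵐ V ∂fieldMeasure (F.P p.K) (k + 1) (SU N),
            chiSeqOfRecord F N θ₀.ν θ₀.τ9.M (gOfRecord₁₃ F N θ₀ p) p.K (k + 1) (seqAllLargeOfRecord F θ₀.ν θ₀.τ9.M (gOfRecord₁₃ F N θ₀ p) p.K (k + 1)) V ≠ 0 →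
              slotsTOfRecord F N θ₀.ν θ₀.τ9 (EOfRecord₁₃ F N θ₀) (wOfRecord₉ F N θ₀.toStage9Params) θ₀.ppSel p (gOfRecord₁₃ F N θ₀ p) (k + 1)
                  (seqAllLargeOfRecord F θ₀.ν θ₀.τ9.M (gOfRecord₁₃ F N θ₀ p) p.K (k + 1)) V =
                sect2Slot F N (FluctV N) p.K (settingOfRecord₁₃ F N θ₀ p)
                  ((Stage13HParams.ofHistoryBlind F N (Stage13RParams.ofCured F N θ₀)).rzAt p
                    (seqAllLargeOfRecord F θ₀.ν θ₀.τ9.M (gOfRecord₁₃ F N θ₀ p) p.K (k + 1)))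
                  (WtOfRecord₁₃H F N (Stage13HParams.ofHistoryBlind F N (Stage13RParams.ofCured F N θ₀)) p
                    (seqAllLargeOfRecord F θ₀.ν θ₀.τ9.M (gOfRecord₁₃ F N θ₀ p) p.K (k + 1)))
                  (seqAllLargeOfRecord F θ₀.ν θ₀.τ9.M (gOfRecord₁₃ F N θ₀ p) p.K (k + 1)) t' E₀
                  (UbgOfRecord₁₃CoP F N θ₀ p (k + 1) (seqAllLargeOfRecord F θ₀.ν θ₀.τ9.M (gOfRecord₁₃ F N θ₀ p) p.K (k + 1))) V) :
    ∀ k, k ≤ p.K → ∃ (t : Sect2.TermValues (F.P p.K) (MatA N) (FluctV N) θ₀.τ9.M) (E : ℝ),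
      Sect2.LawsRT (sect2TowerOfRecord F N (FluctV N) p.K (settingOfRecord₁₃ F N θ₀ p)
        ((Stage13HParams.ofHistoryBlind F N (Stage13RParams.ofCured F N θ₀)).rzAt p (seqAllLargeOfRecord F θ₀.ν θ₀.τ9.M (gOfRecord₁₃ F N θ₀ p) p.K k))
        (seqAllLargeOfRecord F θ₀.ν θ₀.τ9.M (gOfRecord₁₃ F N θ₀ p) p.K k) t) (settingOfRecord₁₃ F N θ₀ p).lf k ∧
     (slotsOfRecord F N θ₀.ν θ₀.τ9 (EOfRecord₁₃ F N θ₀) (wOfRecord₉ F N θ₀.toStage9Params) θ₀.ppSel p (gOfRecord₁₃ F N θ₀ p) k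
          (seqAllLargeOfRecord F θ₀.ν θ₀.τ9.M (gOfRecord₁₃ F N θ₀ p) p.K k) = 0 ∨
        ∀ᵐ U ∂fieldMeasure (F.P p.K) k (SU N),
          chiSeqOfRecord F N θ₀.ν θ₀.τ9.M (gOfRecord₁₃ F N θ₀ p) p.K k (seqAllLargeOfRecord F θ₀.ν θ₀.τ9.M (gOfRecord₁₃ F N θ₀ p) p.K k) U ≠ 0 →
            slotsOfRecord F N θ₀.ν θ₀.τ9 (EOfRecord₁₃ F N θ₀) (wOfRecord₉ F N θ₀.toStage9Params) θ₀.ppSel p (gOfRecord₁₃ F N θ₀ p) k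
                (seqAllLargeOfRecord F θ₀.ν θ₀.τ9.M (gOfRecord₁₃ F N θ₀ p) p.K k) U =
              sect2Slot F N (FluctV N) p.K (settingOfRecord₁₃ F N θ₀ p)
                ((Stage13HParams.ofHistoryBlind F N (Stage13RParams.ofCured F N θ₀)).rzAt p (seqAllLargeOfRecord F θ₀.ν θ₀.τ9.M (gOfRecord₁₃ F N θ₀ p) p.K k))
                (WtOfRecord₁₃H F N (Stage13HParams.ofHistoryBlind F N (Stage13RParams.ofCured F N θ₀)) p
                  (seqAllLargeOfRecord F θ₀.ν θ₀.τ9.M (gOfRecord₁₃ F N θ₀ p) p.K k))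
                (seqAllLargeOfRecord F θ₀.ν θ₀.τ9.M (gOfRecord₁₃ F N θ₀ p) p.K k) t E
                (UbgOfRecord₁₃CoP F N θ₀ p k (seqAllLargeOfRecord F θ₀.ν θ₀.τ9.M (gOfRecord₁₃ F N θ₀ p) p.K k)) U) :=
  diag_lawsRT_slotClause_all_CoPH_of_step_of_liveSel (Stage13HParams.ofHistoryBlind F N (Stage13RParams.ofCured F N θ₀)) p h.ofCured.ofHistoryBlind hg0 hE₀ hB₀
    hsel hstep

end DoorCured

section DoorCuredRecord

variable (F N)
variable (p : B12.RunParams)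

/-- **★★★ … AT THE DOOR OF THE CURED WITNESS OF RECORD** `Stage13HParams.ofHistoryBlind (Stage13RParams.ofCured (theta13LiveOfRecord F N))`, laws included: from `Provisos₁₃Core` AT
THE WITNESS, the run's `0 ≤ g₀` and the displayed per-level diagonal 𝐓-step at that door ONLY (selector clause K0a's `liveRepin₁₃_liveSel`, `E₀ = B₀ = 1` by the family's numerals):
for every `k ≤ K`, BOTH conjuncts of the §2 form of `ρ_k` at the all-large index of length `k`. [cite: Balaban1988Convergent, Thm 1 p.262, §2 p.262, Theorem p.245, (3.24)–(3.25) p.270, (1.11) p.248, (3.16)–(3.22) pp.268–269, (2.27)–(2.31) pp.259–260; Balaban1989LargeFieldI, (0.3)–(0.4) p.176, p.177 (i)–(ii); Balaban1987RG1, (0.20) p.256] -/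
theorem diag_lawsRT_slotClause_all_doorCured_theta13LiveOfRecord_of_step (h : (theta13LiveOfRecord F N).Provisos₁₃Core F N) (hg0 : 0 ≤ p.g0)
    (hstep : ∀ k, k < p.K → ∀ (t₀ : Sect2.TermValues (F.P p.K) (MatA N) (FluctV N) (theta13LiveOfRecord F N).τ9.M) (E₀ : ℝ),
      (slotsOfRecord F N (theta13LiveOfRecord F N).ν (theta13LiveOfRecord F N).τ9 (EOfRecord₁₃ F N (theta13LiveOfRecord F N))
            (wOfRecord₉ F N (theta13LiveOfRecord F N).toStage9Params) (theta13LiveOfRecord F N).ppSel p (gOfRecord₁₃ F N (theta13LiveOfRecord F N) p) k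
            (seqAllLargeOfRecord F (theta13LiveOfRecord F N).ν (theta13LiveOfRecord F N).τ9.M (gOfRecord₁₃ F N (theta13LiveOfRecord F N) p) p.K k) = 0 ∨
          ∀ᵐ U ∂fieldMeasure (F.P p.K) k (SU N),
            chiSeqOfRecord F N (theta13LiveOfRecord F N).ν (theta13LiveOfRecord F N).τ9.M (gOfRecord₁₃ F N (theta13LiveOfRecord F N) p) p.K k
                (seqAllLargeOfRecord F (theta13LiveOfRecord F N).ν (theta13LiveOfRecord F N).τ9.M (gOfRecord₁₃ F N (theta13LiveOfRecord F N) p) p.K k) U ≠ 0 →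
              slotsOfRecord F N (theta13LiveOfRecord F N).ν (theta13LiveOfRecord F N).τ9 (EOfRecord₁₃ F N (theta13LiveOfRecord F N))
                  (wOfRecord₉ F N (theta13LiveOfRecord F N).toStage9Params) (theta13LiveOfRecord F N).ppSel p (gOfRecord₁₃ F N (theta13LiveOfRecord F N) p) k
                  (seqAllLargeOfRecord F (theta13LiveOfRecord F N).ν (theta13LiveOfRecord F N).τ9.M (gOfRecord₁₃ F N (theta13LiveOfRecord F N) p) p.K k) U =
                sect2Slot F N (FluctV N) p.K (settingOfRecord₁₃ F N (theta13LiveOfRecord F N) p)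
                  ((Stage13HParams.ofHistoryBlind F N (Stage13RParams.ofCured F N (theta13LiveOfRecord F N))).rzAt p
                    (seqAllLargeOfRecord F (theta13LiveOfRecord F N).ν (theta13LiveOfRecord F N).τ9.M (gOfRecord₁₃ F N (theta13LiveOfRecord F N) p) p.K k))
                  (WtOfRecord₁₃H F N (Stage13HParams.ofHistoryBlind F N (Stage13RParams.ofCured F N (theta13LiveOfRecord F N))) p
                    (seqAllLargeOfRecord F (theta13LiveOfRecord F N).ν (theta13LiveOfRecord F N).τ9.M (gOfRecord₁₃ F N (theta13LiveOfRecord F N) p) p.K k))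
                  (seqAllLargeOfRecord F (theta13LiveOfRecord F N).ν (theta13LiveOfRecord F N).τ9.M (gOfRecord₁₃ F N (theta13LiveOfRecord F N) p) p.K k) t₀ E₀
                  (UbgOfRecord₁₃CoP F N (theta13LiveOfRecord F N) p k
                    (seqAllLargeOfRecord F (theta13LiveOfRecord F N).ν (theta13LiveOfRecord F N).τ9.M (gOfRecord₁₃ F N (theta13LiveOfRecord F N) p) p.K k)) U) →
      ∀ t' : Sect2.TermValues (F.P p.K) (MatA N) (FluctV N) (theta13LiveOfRecord F N).τ9.M,
        slotsTOfRecord F N (theta13LiveOfRecord F N).ν (theta13LiveOfRecord F N).τ9 (EOfRecord₁₃ F N (theta13LiveOfRecord F N))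
            (wOfRecord₉ F N (theta13LiveOfRecord F N).toStage9Params) (theta13LiveOfRecord F N).ppSel p (gOfRecord₁₃ F N (theta13LiveOfRecord F N) p) (k + 1)
            (seqAllLargeOfRecord F (theta13LiveOfRecord F N).ν (theta13LiveOfRecord F N).τ9.M (gOfRecord₁₃ F N (theta13LiveOfRecord F N) p) p.K (k + 1)) = 0 ∨
          ∀ᵐ V ∂fieldMeasure (F.P p.K) (k + 1) (SU N),
            chiSeqOfRecord F N (theta13LiveOfRecord F N).ν (theta13LiveOfRecord F N).τ9.M (gOfRecord₁₃ F N (theta13LiveOfRecord F N) p) p.K (k + 1)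
                (seqAllLargeOfRecord F (theta13LiveOfRecord F N).ν (theta13LiveOfRecord F N).τ9.M (gOfRecord₁₃ F N (theta13LiveOfRecord F N) p) p.K (k + 1)) V ≠ 0 →
              slotsTOfRecord F N (theta13LiveOfRecord F N).ν (theta13LiveOfRecord F N).τ9 (EOfRecord₁₃ F N (theta13LiveOfRecord F N))
                  (wOfRecord₉ F N (theta13LiveOfRecord F N).toStage9Params) (theta13LiveOfRecord F N).ppSel p (gOfRecord₁₃ F N (theta13LiveOfRecord F N) p) (k + 1)
                  (seqAllLargeOfRecord F (theta13LiveOfRecord F N).ν (theta13LiveOfRecord F N).τ9.M (gOfRecord₁₃ F N (theta13LiveOfRecord F N) p) p.K (k + 1)) V =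
                sect2Slot F N (FluctV N) p.K (settingOfRecord₁₃ F N (theta13LiveOfRecord F N) p)
                  ((Stage13HParams.ofHistoryBlind F N (Stage13RParams.ofCured F N (theta13LiveOfRecord F N))).rzAt p
                    (seqAllLargeOfRecord F (theta13LiveOfRecord F N).ν (theta13LiveOfRecord F N).τ9.M (gOfRecord₁₃ F N (theta13LiveOfRecord F N) p) p.K (k + 1)))
                  (WtOfRecord₁₃H F N (Stage13HParams.ofHistoryBlind F N (Stage13RParams.ofCured F N (theta13LiveOfRecord F N))) p
                    (seqAllLargeOfRecord F (theta13LiveOfRecord F N).ν (theta13LiveOfRecord F N).τ9.M (gOfRecord₁₃ F N (theta13LiveOfRecord F N) p) p.K (k + 1)))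
                  (seqAllLargeOfRecord F (theta13LiveOfRecord F N).ν (theta13LiveOfRecord F N).τ9.M (gOfRecord₁₃ F N (theta13LiveOfRecord F N) p) p.K (k + 1)) t' E₀
                  (UbgOfRecord₁₃CoP F N (theta13LiveOfRecord F N) p (k + 1)
                    (seqAllLargeOfRecord F (theta13LiveOfRecord F N).ν (theta13LiveOfRecord F N).τ9.M (gOfRecord₁₃ F N (theta13LiveOfRecord F N) p) p.K (k + 1))) V) :
    ∀ k, k ≤ p.K → ∃ (t : Sect2.TermValues (F.P p.K) (MatA N) (FluctV N) (theta13LiveOfRecord F N).τ9.M) (E : ℝ),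
      Sect2.LawsRT (sect2TowerOfRecord F N (FluctV N) p.K (settingOfRecord₁₃ F N (theta13LiveOfRecord F N) p)
        ((Stage13HParams.ofHistoryBlind F N (Stage13RParams.ofCured F N (theta13LiveOfRecord F N))).rzAt p
          (seqAllLargeOfRecord F (theta13LiveOfRecord F N).ν (theta13LiveOfRecord F N).τ9.M (gOfRecord₁₃ F N (theta13LiveOfRecord F N) p) p.K k))
        (seqAllLargeOfRecord F (theta13LiveOfRecord F N).ν (theta13LiveOfRecord F N).τ9.M (gOfRecord₁₃ F N (theta13LiveOfRecord F N) p) p.K k) t)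
        (settingOfRecord₁₃ F N (theta13LiveOfRecord F N) p).lf k ∧
     (slotsOfRecord F N (theta13LiveOfRecord F N).ν (theta13LiveOfRecord F N).τ9 (EOfRecord₁₃ F N (theta13LiveOfRecord F N))
          (wOfRecord₉ F N (theta13LiveOfRecord F N).toStage9Params) (theta13LiveOfRecord F N).ppSel p (gOfRecord₁₃ F N (theta13LiveOfRecord F N) p) k
          (seqAllLargeOfRecord F (theta13LiveOfRecord F N).ν (theta13LiveOfRecord F N).τ9.M (gOfRecord₁₃ F N (theta13LiveOfRecord F N) p) p.K k) = 0 ∨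
        ∀ᵐ U ∂fieldMeasure (F.P p.K) k (SU N),
          chiSeqOfRecord F N (theta13LiveOfRecord F N).ν (theta13LiveOfRecord F N).τ9.M (gOfRecord₁₃ F N (theta13LiveOfRecord F N) p) p.K k
              (seqAllLargeOfRecord F (theta13LiveOfRecord F N).ν (theta13LiveOfRecord F N).τ9.M (gOfRecord₁₃ F N (theta13LiveOfRecord F N) p) p.K k) U ≠ 0 →
            slotsOfRecord F N (theta13LiveOfRecord F N).ν (theta13LiveOfRecord F N).τ9 (EOfRecord₁₃ F N (theta13LiveOfRecord F N))
                (wOfRecord₉ F N (theta13LiveOfRecord F N).toStage9Params) (theta13LiveOfRecord F N).ppSel p (gOfRecord₁₃ F N (theta13LiveOfRecord F N) p) k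
                (seqAllLargeOfRecord F (theta13LiveOfRecord F N).ν (theta13LiveOfRecord F N).τ9.M (gOfRecord₁₃ F N (theta13LiveOfRecord F N) p) p.K k) U =
              sect2Slot F N (FluctV N) p.K (settingOfRecord₁₃ F N (theta13LiveOfRecord F N) p)
                ((Stage13HParams.ofHistoryBlind F N (Stage13RParams.ofCured F N (theta13LiveOfRecord F N))).rzAt p
                  (seqAllLargeOfRecord F (theta13LiveOfRecord F N).ν (theta13LiveOfRecord F N).τ9.M (gOfRecord₁₃ F N (theta13LiveOfRecord F N) p) p.K k))
                (WtOfRecord₁₃H F N (Stage13HParams.ofHistoryBlind F N (Stage13RParams.ofCured F N (theta13LiveOfRecord F N))) p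
                  (seqAllLargeOfRecord F (theta13LiveOfRecord F N).ν (theta13LiveOfRecord F N).τ9.M (gOfRecord₁₃ F N (theta13LiveOfRecord F N) p) p.K k))
                (seqAllLargeOfRecord F (theta13LiveOfRecord F N).ν (theta13LiveOfRecord F N).τ9.M (gOfRecord₁₃ F N (theta13LiveOfRecord F N) p) p.K k) t E
                (UbgOfRecord₁₃CoP F N (theta13LiveOfRecord F N) p k
                  (seqAllLargeOfRecord F (theta13LiveOfRecord F N).ν (theta13LiveOfRecord F N).τ9.M (gOfRecord₁₃ F N (theta13LiveOfRecord F N) p) p.K k)) U) :=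
  diag_lawsRT_slotClause_all_doorCured_of_step_of_liveSel (theta13LiveOfRecord F N) p h hg0 zero_le_one zero_le_one
    (liveRepin₁₃_liveSel F N (theta13OfFamily F N eps0OfRecord₁₃ _ _ _)) hstep

end DoorCuredRecord

end Summit.QuantumFields.YangMills.Theorems.BalabanUVNodesN11DiagonalInductionStepCoPH

end
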